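import Literature.Probability.RandomPlanarGeometry.RadialBesselFlow
import Literature.Probability.Process.ContinuousHitting
import Mathlib.Analysis.Real.Pi.Bounds
import HarnessLib

/-!
# The radial Bessel flow: exit times, removal of the truncation, the exit dichotomy

Topic `Probability/RandomPlanarGeometry`; sequel of `RadialBesselFlow` (theorems and definitions,
no named fact). There, for a family of continuous driving paths `U ω` and a truncation level
`0 < δ ≤ π/2`, the **truncated radial Bessel flow** `Y^δ = argTrunc U δ … θ` was constructed:
the everywhere-defined continuous adapted solution of
`Y^δₜ = θ + ∫₀ᵗ cotTrunc δ (Y^δ_s/2) ds - (Uₜ - U₀)`, which follows the radial Bessel equation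
`dY = cot(Y/2) dt - dU` of Lawler (2005), (6.12) / LSW (2002), (2.11) as long as
`Y^δ ∈ [2δ, 2π - 2δ]`. Here we remove the truncation along the levels `δₙ = 1/(n+1)`:

* `truncExit … θ : Ω → WithTop ℝ≥0` — the exit time `σ_δ` of `Y^δ` from `(2δ, 2π - 2δ)`
  (`Literature.Probability.Process.exitTime`; a stopping time for adapted paths,
  `isStoppingTime_truncExit`); up to `σ_δ` the truncation is inactive;
* **consistency** (`argTrunc_eq_argTrunc_of_le_truncExit`): for `δ' ≤ δ` the flows `Y^{δ'}` and
  `Y^δ` agree on `[0, σ_δ]`, whence `σ_δ ≤ σ_{δ'}` (`truncExit_mono`);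
* the **swallowing time of `e^{iθ}`** / lifetime of the radial Bessel process,
  `exitTime U hc θ = ⨆ₙ σ_{δₙ}` (Lawler (2005), §6.4: "the equation is valid until
  `Yₜ ∈ {0, 2π}`"; LSW (2002), p. 5: `T`, "the first time `t` such that `γ[0,t]` disconnects `0`
  from `e^{iθ}`"), a stopping time (`isStoppingTime_exitTime`), with `σ_{δₙ} < T` for all `n`
  when `T < ∞` (`truncExit_lt_exitTime`);
* the **exit dichotomy** (LSW (2002), p. 5: "`Yₜ → 2π` as `t ↑ T` on the event `ν = 1`.
  Similarly `Yₜ → 0` as `t ↑ T` on the event `ν = -1`. Set `Y_T := lim_{t↑T} Yₜ`"): if `T < ∞`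
  then the flows exit their intervals eventually always at the top (`ExitsTop`) or eventually
  always at the bottom (`ExitsBot`), exclusively (`exitsTop_or_exitsBot`,
  `not_exitsTop_and_exitsBot`), and on `ExitsTop` the flow tends to `2π` (on `ExitsBot` to `0`)
  as `t ↑ T`, uniformly along the levels (`eventually_ge_of_exitsTop`,
  `eventually_le_of_exitsBot`); the events are measurable (`measurableSet_exitsTop`).
  The proof is the deterministic observation that a rise of `Y` inside `[π, 2π)` (or a fall
  inside `(0, π]`) goes *against* the drift `cot(Y/2)` and must therefore be paid by an increment
  of the driving function of at least the same size (`sub_le_driving_of_pi_le`), which uniform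
  continuity of `U` on `[0, T]` forbids infinitely often near `T`.

## References

* G. F. Lawler, *Conformally Invariant Processes in the Plane*, AMS (2005), §1.11 (1.16),
  Lemma 1.27; §6.4 (6.12)–(6.13). [Lawler2005]
* G. F. Lawler, O. Schramm, W. Werner, *One-arm exponent for critical 2D percolation*, Electron.
  J. Probab. 7 (2002), no. 2, §2, (2.9)–(2.11) and p. 5. [LawlerSchrammWernerEJP2002]
* D. Revuz, M. Yor, *Continuous Martingales and Brownian Motion* (1999), Ch. I, Prop. (4.6).
-/

noncomputable section

open Set Filter Topology MeasureTheory Metric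

namespace Literature.Probability.RandomPlanarGeometry

namespace RadialLoewner

open scoped NNReal

variable {Ω : Type*} {mΩ : MeasurableSpace Ω} {U : Ω → ℝ≥0 → ℝ}

/-! ### Sign of the clamped drift -/

section DriftSign

variable {δ x : ℝ}

/-- `cotTrunc δ x ≤ 0` for `x ≥ π/2` (`0 < δ ≤ π/2`): the clamp of `x` lies in `[π/2, π)`.
[folklore] -/
theorem cotTrunc_nonpos (hδ : 0 < δ) (hδ' : δ ≤ Real.pi / 2) (hx : Real.pi / 2 ≤ x) :
    cotTrunc δ x ≤ 0 := by
  have hmem := clampI_mem hδ' x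
  have hc : Real.pi / 2 ≤ clampI δ x := by
    unfold clampI
    exact le_max_of_le_right (le_min hx (by linarith))
  rw [cotTrunc_eq_cos_div_sin]
  exact div_nonpos_of_nonpos_of_nonneg
    (Real.cos_nonpos_of_pi_div_two_le_of_le hc (by linarith [hmem.2, Real.pi_pos]))
    (sin_pos_of_mem hδ hmem).le

/-- `0 ≤ cotTrunc δ x` for `x ≤ π/2` (`0 < δ ≤ π/2`): the clamp of `x` lies in `(0, π/2]`.
[folklore] -/
theorem cotTrunc_nonneg (hδ : 0 < δ) (hδ' : δ ≤ Real.pi / 2) (hx : x ≤ Real.pi / 2) :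
    0 ≤ cotTrunc δ x := by
  have hmem := clampI_mem hδ' x
  have hc : clampI δ x ≤ Real.pi / 2 := by
    unfold clampI
    exact max_le hδ' (min_le_of_left_le hx)
  rw [cotTrunc_eq_cos_div_sin]
  exact div_nonneg (Real.cos_nonneg_of_neg_pi_div_two_le_of_le (by linarith [hmem.1]) hc)
    (sin_pos_of_mem hδ hmem).le

end DriftSign

/-! ### Increments of the truncated flow against the drift -/

section Increments

variable (hc : ∀ ω, Continuous (U ω)) {δ : ℝ} (hδ : 0 < δ) (hδ' : δ ≤ Real.pi / 2)
include hc hδ hδ'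

/-- The integrand of the integrated equation is continuous in real time. [folklore] -/
theorem continuous_cotTrunc_argTrunc (θ : ℝ) (ω : Ω) :
    Continuous fun u : ℝ ↦ cotTrunc δ (argTrunc U δ hc hδ hδ' θ u.toNNReal ω / 2) :=
  (continuous_cotTrunc hδ hδ').comp
    (((continuous_argTrunc hc hδ hδ' θ ω).comp continuous_real_toNNReal).div_const _)

/-- **Increments of the truncated flow**: for `s₁ ≤ s₂`,
`Y^δ_{s₂} - Y^δ_{s₁} = ∫_{s₁}^{s₂} cotTrunc δ (Y^δ/2) - (U_{s₂} - U_{s₁})`. [folklore] -/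
theorem argTrunc_sub_argTrunc (θ : ℝ) (ω : Ω) (s₁ s₂ : ℝ≥0) :
    argTrunc U δ hc hδ hδ' θ s₂ ω - argTrunc U δ hc hδ hδ' θ s₁ ω =
      (∫ u in (s₁ : ℝ)..s₂, cotTrunc δ (argTrunc U δ hc hδ hδ' θ u.toNNReal ω / 2)) -
        (U ω s₂ - U ω s₁) := by
  have hg := continuous_cotTrunc_argTrunc hc hδ hδ' θ ω
  rw [argTrunc_eq_integral hc hδ hδ' θ ω (t := s₂), argTrunc_eq_integral hc hδ hδ' θ ω (t := s₁),
    ← intervalIntegral.integral_add_adjacent_intervals (hg.intervalIntegrable 0 s₁)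
      (hg.intervalIntegrable s₁ s₂)]
  ring

/-- **A rise inside `[π, ∞)` is paid by the driving function**: if `Y^δ ≥ π` on `[s₁, s₂]` then
`Y^δ_{s₂} - Y^δ_{s₁} ≤ -(U_{s₂} - U_{s₁})` (the drift `cotTrunc δ (Y^δ/2)` is `≤ 0` there). This is
the deterministic content of "`Yₜ → 2π` as `t ↑ T`" (LSW (2002), p. 5). [folklore] -/
theorem sub_le_driving_of_pi_le (θ : ℝ) (ω : Ω) {s₁ s₂ : ℝ≥0} (h : s₁ ≤ s₂)
    (hpi : ∀ u : ℝ≥0, s₁ ≤ u → u ≤ s₂ → Real.pi ≤ argTrunc U δ hc hδ hδ' θ u ω) :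
    argTrunc U δ hc hδ hδ' θ s₂ ω - argTrunc U δ hc hδ hδ' θ s₁ ω ≤ -(U ω s₂ - U ω s₁) := by
  have hg := continuous_cotTrunc_argTrunc hc hδ hδ' θ ω
  rw [argTrunc_sub_argTrunc hc hδ hδ' θ ω s₁ s₂]
  have hint : (∫ u in (s₁ : ℝ)..s₂, cotTrunc δ (argTrunc U δ hc hδ hδ' θ u.toNNReal ω / 2)) ≤
      ∫ _ in (s₁ : ℝ)..s₂, (0 : ℝ) := by
    refine intervalIntegral.integral_mono_on (by exact_mod_cast h) (hg.intervalIntegrable _ _)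
      intervalIntegrable_const fun u hu ↦ cotTrunc_nonpos hδ hδ' ?_
    have hu0 : 0 ≤ u := s₁.coe_nonneg.trans hu.1
    have h1 : s₁ ≤ u.toNNReal := by
      rw [← NNReal.coe_le_coe, Real.coe_toNNReal _ hu0]; exact hu.1
    have h2 : u.toNNReal ≤ s₂ := by
      rw [← NNReal.coe_le_coe, Real.coe_toNNReal _ hu0]; exact hu.2
    linarith [hpi _ h1 h2]
  rw [intervalIntegral.integral_const, smul_zero] at hint
  linarith

/-- **A fall inside `(-∞, π]` is paid by the driving function**: if `Y^δ ≤ π` on `[s₁, s₂]` then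
`-(U_{s₂} - U_{s₁}) ≤ Y^δ_{s₂} - Y^δ_{s₁}`. [folklore] -/
theorem driving_le_sub_of_le_pi (θ : ℝ) (ω : Ω) {s₁ s₂ : ℝ≥0} (h : s₁ ≤ s₂)
    (hpi : ∀ u : ℝ≥0, s₁ ≤ u → u ≤ s₂ → argTrunc U δ hc hδ hδ' θ u ω ≤ Real.pi) :
    -(U ω s₂ - U ω s₁) ≤ argTrunc U δ hc hδ hδ' θ s₂ ω - argTrunc U δ hc hδ hδ' θ s₁ ω := by
  have hg := continuous_cotTrunc_argTrunc hc hδ hδ' θ ω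
  rw [argTrunc_sub_argTrunc hc hδ hδ' θ ω s₁ s₂]
  have hint : (∫ _ in (s₁ : ℝ)..s₂, (0 : ℝ)) ≤
      ∫ u in (s₁ : ℝ)..s₂, cotTrunc δ (argTrunc U δ hc hδ hδ' θ u.toNNReal ω / 2) := by
    refine intervalIntegral.integral_mono_on (by exact_mod_cast h) intervalIntegrable_const
      (hg.intervalIntegrable _ _) fun u hu ↦ cotTrunc_nonneg hδ hδ' ?_
    have hu0 : 0 ≤ u := s₁.coe_nonneg.trans hu.1
    have h1 : s₁ ≤ u.toNNReal := by
      rw [← NNReal.coe_le_coe, Real.coe_toNNReal _ hu0]; exact hu.1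
    have h2 : u.toNNReal ≤ s₂ := by
      rw [← NNReal.coe_le_coe, Real.coe_toNNReal _ hu0]; exact hu.2
    linarith [hpi _ h1 h2]
  rw [intervalIntegral.integral_const, smul_zero] at hint
  linarith

end Increments

/-! ### Consistency of the truncation levels -/

section Consistency

variable (hc : ∀ ω, Continuous (U ω))
include hc

/-- **Consistency of the levels**: if `δ' ≤ δ` and the level-`δ` flow stays in `[2δ, 2π - 2δ]` on
`[0, t]`, then the level-`δ'` flow coincides with it on `[0, t]` (both solve the level-`δ'`
equation there: uniqueness, `eqOn_argTrunc_of_integral_eq`). [folklore] -/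
theorem argTrunc_eq_argTrunc_of_forall_mem {δ δ' : ℝ} (hδ : 0 < δ) (hδ₂ : δ ≤ Real.pi / 2)
    (hδ' : 0 < δ') (hδ'₂ : δ' ≤ Real.pi / 2) (hle : δ' ≤ δ) (θ : ℝ) (ω : Ω) {t : ℝ≥0}
    (hmem : ∀ s : ℝ≥0, s ≤ t →
      argTrunc U δ hc hδ hδ₂ θ s ω ∈ Icc (2 * δ) (2 * Real.pi - 2 * δ)) :
    ∀ s : ℝ≥0, s ≤ t → argTrunc U δ' hc hδ' hδ'₂ θ s ω = argTrunc U δ hc hδ hδ₂ θ s ω := by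
  intro s hs
  symm
  refine eqOn_argTrunc_of_integral_eq hc hδ' hδ'₂ θ ω (continuous_argTrunc hc hδ hδ₂ θ ω)
    (fun r hr ↦ ?_) s hs
  rw [argTrunc_eq_integral hc hδ hδ₂ θ ω (t := r)]
  congr 2
  refine intervalIntegral.integral_congr fun u hu ↦ ?_
  rw [uIcc_of_le r.coe_nonneg] at hu
  have hut : u.toNNReal ≤ t := ((Real.toNNReal_le_iff_le_coe).2 hu.2).trans hr
  have hy := hmem _ hut
  have hy2 : argTrunc U δ hc hδ hδ₂ θ u.toNNReal ω / 2 ∈ Icc δ (Real.pi - δ) := by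
    constructor <;> linarith [hy.1, hy.2]
  have hy2' : argTrunc U δ hc hδ hδ₂ θ u.toNNReal ω / 2 ∈ Icc δ' (Real.pi - δ') :=
    ⟨hle.trans hy2.1, hy2.2.trans (by linarith)⟩
  rw [cotTrunc_eq_cot hy2, cotTrunc_eq_cot hy2']

end Consistency

/-! ### Exit times of the truncated flows -/

section TruncExit

variable (U) in
/-- **The exit time `σ_δ` of the level-`δ` flow from `(2δ, 2π - 2δ)`**
(`Literature.Probability.Process.exitTime`, valued in `WithTop ℝ≥0`; `⊤` if it never exits). Up
to `σ_δ` the truncation is inactive, so `Y^δ` is the radial Bessel flow there; `σ_δ` is the radial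
analogue of Lawler's `σ(y₁, y₂)` (Lawler (2005), proof of Lemma 1.25). [cite: Lawler2005, §1.11 Lemma 1.25] -/
def truncExit (hc : ∀ ω, Continuous (U ω)) {δ : ℝ} (hδ : 0 < δ) (hδ' : δ ≤ Real.pi / 2) (θ : ℝ) :
    Ω → WithTop ℝ≥0 :=
  Process.exitTime (argTrunc U δ hc hδ hδ' θ) (2 * δ) (2 * Real.pi - 2 * δ)

variable (hc : ∀ ω, Continuous (U ω)) {δ : ℝ} (hδ : 0 < δ) (hδ' : δ ≤ Real.pi / 2)

/-- Unfolding of `truncExit`. [folklore] -/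
theorem truncExit_def (θ : ℝ) :
    truncExit U hc hδ hδ' θ = Process.exitTime (argTrunc U δ hc hδ hδ' θ) (2 * δ) (2 * Real.pi - 2 * δ) :=
  rfl

/-- Before `σ_δ` the flow is inside `(2δ, 2π - 2δ)`. [folklore] -/
theorem argTrunc_mem_Ioo_of_lt_truncExit (θ : ℝ) (ω : Ω) {s : ℝ≥0}
    (hs : (s : WithTop ℝ≥0) < truncExit U hc hδ hδ' θ ω) :
    argTrunc U δ hc hδ hδ' θ s ω ∈ Ioo (2 * δ) (2 * Real.pi - 2 * δ) :=
  Process.mem_Ioo_of_coe_lt_exitTime hs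

/-- Up to and including `σ_δ` the flow is in `[2δ, 2π - 2δ]` (start inside). [folklore] -/
theorem argTrunc_mem_Icc_of_le_truncExit {θ : ℝ} (hθ : θ ∈ Ioo (2 * δ) (2 * Real.pi - 2 * δ))
    (ω : Ω) {s : ℝ≥0} (hs : (s : WithTop ℝ≥0) ≤ truncExit U hc hδ hδ' θ ω) :
    argTrunc U δ hc hδ hδ' θ s ω ∈ Icc (2 * δ) (2 * Real.pi - 2 * δ) := by
  have h := Process.stoppedProcess_exitTime_mem_Icc (u := argTrunc U δ hc hδ hδ' θ)
    (continuous_argTrunc hc hδ hδ' θ ω) (by rwa [argTrunc_zero]) s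
  rwa [Process.stoppedProcess_exitTime_eq_of_le hs] at h

/-- `σ_δ > 0` for a start inside the interval. [folklore] -/
theorem truncExit_pos {θ : ℝ} (hθ : θ ∈ Ioo (2 * δ) (2 * Real.pi - 2 * δ)) (ω : Ω) :
    0 < truncExit U hc hδ hδ' θ ω :=
  Process.exitTime_pos (continuous_argTrunc hc hδ hδ' θ ω) (by rwa [argTrunc_zero])

/-- At a finite exit time the flow sits at an endpoint `2δ` or `2π - 2δ`. [folklore] -/
theorem argTrunc_truncExit_eq_or {θ : ℝ} (hθ : θ ∈ Ioo (2 * δ) (2 * Real.pi - 2 * δ)) (ω : Ω)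
    {T : ℝ≥0} (hT : truncExit U hc hδ hδ' θ ω = T) :
    argTrunc U δ hc hδ hδ' θ T ω = 2 * δ ∨ argTrunc U δ hc hδ hδ' θ T ω = 2 * Real.pi - 2 * δ :=
  Process.apply_eq_or_eq_of_exitTime_eq_coe (continuous_argTrunc hc hδ hδ' θ ω)
    (by rwa [argTrunc_zero]) hT

/-- If the path is inside the open interval at all times `≤ t`, the exit time is `> t`.
[folklore] -/
theorem lt_truncExit_of_forall_mem (θ : ℝ) (ω : Ω) {t : ℝ≥0}
    (h : ∀ s : ℝ≥0, s ≤ t → argTrunc U δ hc hδ hδ' θ s ω ∈ Ioo (2 * δ) (2 * Real.pi - 2 * δ)) :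
    (t : WithTop ℝ≥0) < truncExit U hc hδ hδ' θ ω := by
  by_contra hle
  rw [not_lt] at hle
  obtain ⟨j, hj, hjout⟩ := (Process.exitTime_le_coe_iff
    (continuous_argTrunc hc hδ hδ' θ ω)).1 hle
  exact hjout (h j hj)

/-- **`σ_δ` is a stopping time** of any filtration to which the driving path is adapted
(hitting time of a closed set by a continuous adapted process; Revuz–Yor (1999), Ch. I,
Prop. (4.6)). [folklore] -/
theorem isStoppingTime_truncExit {𝓕 : Filtration ℝ≥0 mΩ}
    (hU : ∀ s, Measurable[𝓕 s] fun ω ↦ U ω s) (θ : ℝ) :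
    IsStoppingTime 𝓕 (truncExit U hc hδ hδ' θ) :=
  Process.isStoppingTime_exitTime (adapted_argTrunc hc hδ hδ' hU θ)
    (continuous_argTrunc hc hδ hδ' θ)

/-- **Consistency up to the exit time**: for `δ' ≤ δ` and a start inside the level-`δ` interval,
`Y^{δ'} = Y^δ` on `[0, σ_δ]`. [folklore] -/
theorem argTrunc_eq_argTrunc_of_le_truncExit {δ' : ℝ} (hδ'₁ : 0 < δ') (hδ'₂ : δ' ≤ Real.pi / 2)
    (hle : δ' ≤ δ) {θ : ℝ} (hθ : θ ∈ Ioo (2 * δ) (2 * Real.pi - 2 * δ)) (ω : Ω) {s : ℝ≥0}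
    (hs : (s : WithTop ℝ≥0) ≤ truncExit U hc hδ hδ' θ ω) :
    argTrunc U δ' hc hδ'₁ hδ'₂ θ s ω = argTrunc U δ hc hδ hδ' θ s ω :=
  argTrunc_eq_argTrunc_of_forall_mem hc hδ hδ' hδ'₁ hδ'₂ hle θ ω
    (fun _ hr ↦ argTrunc_mem_Icc_of_le_truncExit hc hδ hδ' hθ ω
      ((WithTop.coe_le_coe.2 hr).trans hs)) s le_rfl

/-- **Monotonicity of the exit times in the level**: `σ_δ ≤ σ_{δ'}` for `δ' ≤ δ` (start inside
the level-`δ` interval). [folklore] -/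
theorem truncExit_mono {δ' : ℝ} (hδ'₁ : 0 < δ') (hδ'₂ : δ' ≤ Real.pi / 2) (hle : δ' ≤ δ)
    {θ : ℝ} (hθ : θ ∈ Ioo (2 * δ) (2 * Real.pi - 2 * δ)) (ω : Ω) :
    truncExit U hc hδ hδ' θ ω ≤ truncExit U hc hδ'₁ hδ'₂ θ ω := by
  -- it suffices that every finite time below `σ_δ` is below `σ_{δ'}`
  -- (cf. `WithTop.le_of_forall_coe_lt` of `SLEBoundaryHittingProofs`)
  suffices h : ∀ t : ℝ≥0, (t : WithTop ℝ≥0) < truncExit U hc hδ hδ' θ ω →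
      (t : WithTop ℝ≥0) < truncExit U hc hδ'₁ hδ'₂ θ ω by
    by_contra hba
    rw [not_le] at hba
    obtain ⟨t, ht⟩ := WithTop.ne_top_iff_exists.1 (ne_top_of_lt hba)
    rw [← ht] at hba
    have := h t hba
    rw [ht] at this
    exact lt_irrefl _ this
  refine fun t ht ↦ lt_truncExit_of_forall_mem hc hδ'₁ hδ'₂ θ ω fun s hs ↦ ?_
  have hst : (s : WithTop ℝ≥0) < truncExit U hc hδ hδ' θ ω := (WithTop.coe_le_coe.2 hs).trans_lt ht
  rw [argTrunc_eq_argTrunc_of_le_truncExit hc hδ hδ' hδ'₁ hδ'₂ hle hθ ω hst.le]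
  have hin := argTrunc_mem_Ioo_of_lt_truncExit hc hδ hδ' θ ω hst
  exact ⟨by linarith [hin.1], by linarith [hin.2]⟩

end TruncExit

/-! ### A real-variable lemma: the last crossing of a level -/

section Crossing

/-- **Last crossing of a level from below**: a continuous `y` with `y a ≤ c < y b` (`a ≤ b`) has
a last time `L ∈ [a, b)` at level `c`, after which it stays strictly above `c` up to `b`.
[folklore] -/
theorem exists_last_crossing {y : ℝ≥0 → ℝ} (hy : Continuous y) {a b : ℝ≥0} (hab : a ≤ b)
    {c : ℝ} (ha : y a ≤ c) (hb : c < y b) :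
    ∃ L : ℝ≥0, a ≤ L ∧ L < b ∧ y L = c ∧ ∀ u : ℝ≥0, L < u → u ≤ b → c < y u := by
  set S : Set ℝ≥0 := {u | u ∈ Icc a b ∧ y u ≤ c} with hS
  have hSc : IsClosed S := isClosed_Icc.inter (isClosed_le hy continuous_const)
  have hSne : S.Nonempty := ⟨a, ⟨le_rfl, hab⟩, ha⟩
  have hSbdd : BddAbove S := ⟨b, fun u hu ↦ hu.1.2⟩
  set L := sSup S with hL
  have hLS : L ∈ S := hSc.csSup_mem hSne hSbdd
  have habove : ∀ u : ℝ≥0, L < u → u ≤ b → c < y u := by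
    intro u hLu hub
    by_contra hyu
    rw [not_lt] at hyu
    have huS : u ∈ S := ⟨⟨hLS.1.1.trans hLu.le, hub⟩, hyu⟩
    exact not_le.2 hLu (le_csSup hSbdd huS)
  have hLb : L < b := by
    rcases hLS.1.2.eq_or_lt with h | h
    · exact absurd hLS.2 (by rw [h]; exact not_le.2 hb)
    · exact h
  refine ⟨L, hLS.1.1, hLb, ?_, habove⟩
  -- `y L = c`: `y L ≤ c`, and `y L < c` would propagate to the right of `L`
  refine le_antisymm hLS.2 (not_lt.1 fun hlt ↦ ?_)
  have hev : ∀ᶠ u in 𝓝[>] L, y u < c :=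
    ((hy.continuousAt.eventually (gt_mem_nhds hlt)).filter_mono nhdsWithin_le_nhds)
  obtain ⟨u, hu, huI⟩ := (hev.and (Ioc_mem_nhdsGT hLb)).exists
  exact (lt_irrefl c) ((habove u huI.1 huI.2).trans hu)

/-- **Last crossing of a level from above**: a continuous `y` with `y b < c ≤ y a` (`a ≤ b`) has
a last time `L ∈ [a, b)` at level `c`, after which it stays strictly below `c` up to `b`.
[folklore] -/
theorem exists_last_crossing' {y : ℝ≥0 → ℝ} (hy : Continuous y) {a b : ℝ≥0} (hab : a ≤ b)
    {c : ℝ} (ha : c ≤ y a) (hb : y b < c) :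
    ∃ L : ℝ≥0, a ≤ L ∧ L < b ∧ y L = c ∧ ∀ u : ℝ≥0, L < u → u ≤ b → y u < c := by
  obtain ⟨L, h1, h2, h3, h4⟩ := exists_last_crossing (y := fun u ↦ -y u) hy.neg hab (c := -c)
    (neg_le_neg ha) (neg_lt_neg hb)
  exact ⟨L, h1, h2, by simpa using h3, fun u hu hub ↦ by simpa using h4 u hu hub⟩

end Crossing

/-! ### The truncation levels `δₙ = 1/(n+1)` -/

section Levels

/-- The truncation levels `δₙ = 1/(n+1)`. [folklore] -/
def level (n : ℕ) : ℝ :=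
  1 / (n + 1)

/-- `δₙ > 0`. [folklore] -/
theorem level_pos (n : ℕ) : 0 < level n :=
  Nat.one_div_pos_of_nat

/-- `δₙ ≤ 1`. [folklore] -/
theorem level_le_one (n : ℕ) : level n ≤ 1 := by
  rw [level, div_le_one (by positivity)]
  linarith [n.cast_nonneg (α := ℝ)]

/-- `δₙ ≤ π/2`. [folklore] -/
theorem level_le (n : ℕ) : level n ≤ Real.pi / 2 := by
  linarith [level_le_one n, Real.pi_gt_three]

/-- `δₙ ≤ 1/2` for `n ≥ 1`. [folklore] -/
theorem level_le_half {n : ℕ} (hn : 1 ≤ n) : level n ≤ 1 / 2 := by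
  rw [level]
  have : (2 : ℝ) ≤ n + 1 := by
    have : (1 : ℝ) ≤ n := by exact_mod_cast hn
    linarith
  exact one_div_le_one_div_of_le (by norm_num) this

/-- The levels decrease. [folklore] -/
theorem level_antitone : Antitone level := fun n m hnm ↦
  one_div_le_one_div_of_le (by positivity) (by exact_mod_cast Nat.succ_le_succ hnm)

/-- The levels decrease strictly. [folklore] -/
theorem level_strictAnti : StrictAnti level := fun n m hnm ↦
  one_div_lt_one_div_of_lt (by positivity) (by exact_mod_cast Nat.succ_lt_succ hnm)

/-- `δₙ → 0`. [folklore] -/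
theorem tendsto_level : Tendsto level atTop (𝓝 0) :=
  tendsto_one_div_add_atTop_nhds_zero_nat

/-- A point of `(0, 2π)` lies in `(2δₙ, 2π - 2δₙ)` for all large `n`. [folklore] -/
theorem eventually_mem_Ioo_level {θ : ℝ} (hθ : θ ∈ Ioo 0 (2 * Real.pi)) :
    ∃ N : ℕ, ∀ n, N ≤ n → θ ∈ Ioo (2 * level n) (2 * Real.pi - 2 * level n) := by
  have hm : 0 < min θ (2 * Real.pi - θ) / 2 := by
    have := lt_min hθ.1 (by linarith [hθ.2] : 0 < 2 * Real.pi - θ); linarith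
  obtain ⟨N, hN⟩ := (tendsto_level.eventually (gt_mem_nhds hm)).exists_forall_of_atTop
  refine ⟨N, fun n hn ↦ ?_⟩
  have h := hN n hn
  have h1 := min_le_left θ (2 * Real.pi - θ)
  have h2 := min_le_right θ (2 * Real.pi - θ)
  constructor <;> linarith

/-- If `θ` lies in the level-`n` interval it lies in all later ones. [folklore] -/
theorem mem_Ioo_level_mono {θ : ℝ} {n m : ℕ} (hnm : n ≤ m)
    (h : θ ∈ Ioo (2 * level n) (2 * Real.pi - 2 * level n)) :
    θ ∈ Ioo (2 * level m) (2 * Real.pi - 2 * level m) := by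
  have := level_antitone hnm
  exact ⟨by linarith [h.1], by linarith [h.2]⟩

end Levels

/-! ### The lifetime (swallowing time) and the exit dichotomy -/

section Lifetime

variable (U) in
/-- The level-`n` truncated radial Bessel flow `Y^{δₙ}`. [folklore] -/
abbrev argLevel (hc : ∀ ω, Continuous (U ω)) (n : ℕ) (θ : ℝ) : ℝ≥0 → Ω → ℝ :=
  argTrunc U (level n) hc (level_pos n) (level_le n) θ

variable (U) in
/-- The exit time `σₙ` of the level-`n` flow from `(2δₙ, 2π - 2δₙ)`. [folklore] -/
abbrev exitLevel (hc : ∀ ω, Continuous (U ω)) (n : ℕ) (θ : ℝ) : Ω → WithTop ℝ≥0 :=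
  truncExit U hc (level_pos n) (level_le n) θ

variable (U) in
/-- **The lifetime `T = ⨆ₙ σₙ` of the radial Bessel flow started at `θ`** — for the radial
Loewner chain, the swallowing time of the boundary point `e^{iθ}` (Lawler (2005), §6.4: the
equation (6.12) "is valid until `Yₜ ∈ {0, 2π}`"; LSW (2002), p. 5: `T`, "the first time `t` such
that `γ_ra[0, t]` disconnects `0` from `e^{iθ}`"). Valued in `WithTop ℝ≥0` (`⊤`: never).
[cite: Lawler2005, §6.4 eq. (6.12)] -/
def lifetime (hc : ∀ ω, Continuous (U ω)) (θ : ℝ) (ω : Ω) : WithTop ℝ≥0 :=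
  ⨆ n : ℕ, exitLevel U hc n θ ω

variable (hc : ∀ ω, Continuous (U ω))

/-- If the start is not inside the level-`n` interval, `σₙ = 0`. [folklore] -/
theorem exitLevel_eq_zero_of_not_mem {n : ℕ} {θ : ℝ}
    (h : θ ∉ Ioo (2 * level n) (2 * Real.pi - 2 * level n)) (ω : Ω) :
    exitLevel U hc n θ ω = 0 := by
  refine le_antisymm ((Process.exitTime_le_coe_iff
    (continuous_argTrunc hc (level_pos n) (level_le n) θ ω)).2 ⟨0, le_rfl, ?_⟩) bot_le
  rwa [argTrunc_zero]

/-- **The exit times increase along the levels** (every path, every start). [folklore] -/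
theorem exitLevel_mono (θ : ℝ) (ω : Ω) : Monotone fun n ↦ exitLevel U hc n θ ω := by
  intro n m hnm
  by_cases hθ : θ ∈ Ioo (2 * level n) (2 * Real.pi - 2 * level n)
  · exact truncExit_mono hc (level_pos n) (level_le n) (level_pos m) (level_le m)
      (level_antitone hnm) hθ ω
  · simp only [exitLevel_eq_zero_of_not_mem hc hθ ω]
    exact bot_le

/-- `σₙ ≤ T`. [folklore] -/
theorem exitLevel_le_lifetime (n : ℕ) (θ : ℝ) (ω : Ω) :
    exitLevel U hc n θ ω ≤ lifetime U hc θ ω :=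
  le_iSup (fun n ↦ exitLevel U hc n θ ω) n

/-- **Consistency along the levels**: for `n ≤ m`, `Y^{δₘ} = Y^{δₙ}` on `[0, σₙ]` (start inside
the level-`n` interval). [folklore] -/
theorem argLevel_eq_argLevel_of_le {n m : ℕ} (hnm : n ≤ m) {θ : ℝ}
    (hθ : θ ∈ Ioo (2 * level n) (2 * Real.pi - 2 * level n)) (ω : Ω) {s : ℝ≥0}
    (hs : (s : WithTop ℝ≥0) ≤ exitLevel U hc n θ ω) :
    argLevel U hc m θ s ω = argLevel U hc n θ s ω :=
  argTrunc_eq_argTrunc_of_le_truncExit hc (level_pos n) (level_le n) (level_pos m) (level_le m)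
    (level_antitone hnm) hθ ω hs

/-- **`σₙ < T` for every `n` if `T < ∞`** (start in `(0, 2π)`): at `σₙ` the flow sits at an
endpoint of the level-`n` interval, strictly inside the level-`(n+1)` interval, so
`σₙ < σₙ₊₁ ≤ T`. [folklore] -/
theorem exitLevel_lt_lifetime {θ : ℝ} (hθ : θ ∈ Ioo 0 (2 * Real.pi)) {ω : Ω}
    (hT : lifetime U hc θ ω < ⊤) (n : ℕ) : exitLevel U hc n θ ω < lifetime U hc θ ω := by
  refine lt_of_le_of_ne (exitLevel_le_lifetime hc n θ ω) fun heq ↦ ?_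
  obtain ⟨N, hN⟩ := eventually_mem_Ioo_level hθ
  have hne : exitLevel U hc n θ ω ≠ ⊤ := by rw [heq]; exact hT.ne
  obtain ⟨t₀, ht₀⟩ := WithTop.ne_top_iff_exists.1 hne
  by_cases hθn : θ ∈ Ioo (2 * level n) (2 * Real.pi - 2 * level n)
  · -- the level-`(m)` flow, `m = max (n+1) N`, is strictly inside its interval on `[0, t₀]`
    set m := n + 1 with hm
    have hθm : θ ∈ Ioo (2 * level m) (2 * Real.pi - 2 * level m) := mem_Ioo_level_mono (by omega) hθn
    have hlt : (t₀ : WithTop ℝ≥0) < exitLevel U hc m θ ω := by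
      refine lt_truncExit_of_forall_mem hc (level_pos m) (level_le m) θ ω fun s hs ↦ ?_
      have hs' : (s : WithTop ℝ≥0) ≤ exitLevel U hc n θ ω := by
        rw [← ht₀]; exact WithTop.coe_le_coe.2 hs
      change argLevel U hc m θ s ω ∈ Ioo (2 * level m) (2 * Real.pi - 2 * level m)
      rw [argLevel_eq_argLevel_of_le hc (Nat.le_succ n) hθn ω hs']
      have hmem := argTrunc_mem_Icc_of_le_truncExit hc (level_pos n) (level_le n) hθn ω hs'
      have hlev : level m < level n := level_strictAnti (Nat.lt_succ_self n)
      exact ⟨by linarith [hmem.1], by linarith [hmem.2]⟩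
    have hle : exitLevel U hc m θ ω ≤ exitLevel U hc n θ ω := by
      rw [heq]; exact exitLevel_le_lifetime hc m θ ω
    rw [← ht₀] at hle
    exact not_lt.2 hle hlt
  · have h0 : exitLevel U hc n θ ω = 0 := exitLevel_eq_zero_of_not_mem hc hθn ω
    set m := max n N with hm
    have hθm := hN m (le_max_right _ _)
    have hpos := truncExit_pos hc (level_pos m) (level_le m) hθm ω
    have hle : exitLevel U hc m θ ω ≤ exitLevel U hc n θ ω := by
      rw [heq]; exact exitLevel_le_lifetime hc m θ ω
    rw [h0] at hle
    exact not_lt.2 hle hpos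

/-- **`T` is a stopping time** of any filtration to which the driving path is adapted
(`{T ≤ t} = ⋂ₙ {σₙ ≤ t}`). [folklore] -/
theorem isStoppingTime_lifetime {𝓕 : Filtration ℝ≥0 mΩ}
    (hU : ∀ s, Measurable[𝓕 s] fun ω ↦ U ω s) (θ : ℝ) :
    IsStoppingTime 𝓕 (lifetime U hc θ) := by
  intro t
  have : {ω | lifetime U hc θ ω ≤ t} = ⋂ n : ℕ, {ω | exitLevel U hc n θ ω ≤ t} := by
    ext ω; simp only [lifetime, mem_setOf_eq, iSup_le_iff, mem_iInter]
  rw [this]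
  exact MeasurableSet.iInter fun n ↦ isStoppingTime_truncExit hc (level_pos n) (level_le n) hU θ t

variable (U) in
/-- **The level-`n` flow exits at the top**: `σₙ < ∞` and `Y^{δₙ}(σₙ) = 2π - 2δₙ`. [folklore] -/
def TopAt (hc : ∀ ω, Continuous (U ω)) (n : ℕ) (θ : ℝ) (ω : Ω) : Prop :=
  ∃ t : ℝ≥0, exitLevel U hc n θ ω = t ∧ argLevel U hc n θ t ω = 2 * Real.pi - 2 * level n

variable (U) in
/-- **The level-`n` flow exits at the bottom**: `σₙ < ∞` and `Y^{δₙ}(σₙ) = 2δₙ`. [folklore] -/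
def BotAt (hc : ∀ ω, Continuous (U ω)) (n : ℕ) (θ : ℝ) (ω : Ω) : Prop :=
  ∃ t : ℝ≥0, exitLevel U hc n θ ω = t ∧ argLevel U hc n θ t ω = 2 * level n

variable (U) in
/-- **The flow leaves `(0, 2π)` through `2π`** (LSW's event `ν = 1`, `Y_T = 2π`; p. 5):
eventually every level exits at the top. [cite: LawlerSchrammWernerEJP2002, §2 p. 5] -/
def ExitsTop (hc : ∀ ω, Continuous (U ω)) (θ : ℝ) (ω : Ω) : Prop :=
  ∃ N : ℕ, ∀ n, N ≤ n → TopAt U hc n θ ω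

variable (U) in
/-- **The flow leaves `(0, 2π)` through `0`** (LSW's event `ν = -1`, `Y_T = 0`; p. 5):
eventually every level exits at the bottom. [cite: LawlerSchrammWernerEJP2002, §2 p. 5] -/
def ExitsBot (hc : ∀ ω, Continuous (U ω)) (θ : ℝ) (ω : Ω) : Prop :=
  ∃ N : ℕ, ∀ n, N ≤ n → BotAt U hc n θ ω

/-- A level cannot exit at both ends (`2δₙ < 2π - 2δₙ`). [folklore] -/
theorem not_topAt_and_botAt (n : ℕ) (θ : ℝ) (ω : Ω) : ¬(TopAt U hc n θ ω ∧ BotAt U hc n θ ω) := by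
  rintro ⟨⟨t, ht, hyt⟩, ⟨t', ht', hyt'⟩⟩
  have htt : t = t' := WithTop.coe_injective (ht.symm.trans ht')
  rw [← htt, hyt] at hyt'
  linarith [level_le_one n, Real.pi_gt_three]

/-- `ExitsTop` and `ExitsBot` exclude each other. [folklore] -/
theorem not_exitsTop_and_exitsBot (θ : ℝ) (ω : Ω) :
    ¬(ExitsTop U hc θ ω ∧ ExitsBot U hc θ ω) := by
  rintro ⟨⟨N, hN⟩, ⟨N', hN'⟩⟩
  exact not_topAt_and_botAt hc (max N N') θ ω ⟨hN _ (le_max_left _ _), hN' _ (le_max_right _ _)⟩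

/-- If `T < ∞` and the start is inside the level-`n` interval, level `n` exits at the top or at
the bottom. [folklore] -/
theorem topAt_or_botAt {θ : ℝ} (hθ : θ ∈ Ioo 0 (2 * Real.pi)) {n : ℕ}
    (hθn : θ ∈ Ioo (2 * level n) (2 * Real.pi - 2 * level n)) {ω : Ω}
    (hT : lifetime U hc θ ω < ⊤) : TopAt U hc n θ ω ∨ BotAt U hc n θ ω := by
  have hne : exitLevel U hc n θ ω ≠ ⊤ := ((exitLevel_lt_lifetime hc hθ hT n).trans hT).ne
  obtain ⟨t, ht⟩ := WithTop.ne_top_iff_exists.1 hne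
  rcases argTrunc_truncExit_eq_or hc (level_pos n) (level_le n) hθn ω ht.symm with h | h
  · exact Or.inr ⟨t, ht.symm, h⟩
  · exact Or.inl ⟨t, ht.symm, h⟩

include hc in
/-- Uniform continuity of the driving path on `[0, t₀]`, quantified. [folklore] -/
theorem exists_modulus (ω : Ω) (t₀ : ℝ≥0) {ε : ℝ} (hε : 0 < ε) :
    ∃ η > 0, ∀ s s' : ℝ≥0, s ≤ t₀ → s' ≤ t₀ → dist s s' < η → |U ω s - U ω s'| < ε := by
  have huc := (isCompact_Icc (a := (0 : ℝ≥0)) (b := t₀)).uniformContinuousOn_of_continuous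
    (hc ω).continuousOn
  obtain ⟨η, hη, h⟩ := Metric.uniformContinuousOn_iff.1 huc ε hε
  exact ⟨η, hη, fun s s' hs hs' hd ↦ by
    simpa [Real.dist_eq] using h s ⟨bot_le, hs⟩ s' ⟨bot_le, hs'⟩ hd⟩

/-- The exit times approach the finite lifetime: for `t < T`, eventually `t < σₙ`. [folklore] -/
theorem eventually_lt_exitLevel {θ : ℝ} {ω : Ω} {t : ℝ≥0}
    (ht : (t : WithTop ℝ≥0) < lifetime U hc θ ω) :
    ∃ N : ℕ, ∀ n, N ≤ n → (t : WithTop ℝ≥0) < exitLevel U hc n θ ω := by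
  obtain ⟨N, hN⟩ := lt_iSup_iff.1 ht
  exact ⟨N, fun n hn ↦ hN.trans_le (exitLevel_mono hc θ ω hn)⟩

/-- **The exit dichotomy** (LSW (2002), p. 5: `Y_T := lim_{t↑T} Yₜ ∈ {0, 2π}` exists): if the
lifetime is finite, then eventually all levels exit at the top, or eventually all exit at the
bottom. Proof: a switch of sides between levels `n < m` near `T` forces a rise of the flow from
`π` to `2π - 2δₘ` inside `[π, 2π)` (or a fall from `π` to `2δₘ` inside `(0, π]`), i.e. against the
drift, which costs an increment `≥ π - 1` of the driving function over a time interval shorter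
than its modulus of continuity for `1` — impossible. [cite: LawlerSchrammWernerEJP2002, §2 p. 5] -/
theorem exitsTop_or_exitsBot {θ : ℝ} (hθ : θ ∈ Ioo 0 (2 * Real.pi)) {ω : Ω}
    (hT : lifetime U hc θ ω < ⊤) : ExitsTop U hc θ ω ∨ ExitsBot U hc θ ω := by
  obtain ⟨t₀, ht₀⟩ := WithTop.ne_top_iff_exists.1 hT.ne
  obtain ⟨η, hη, hmod⟩ := exists_modulus hc ω t₀ one_pos
  obtain ⟨N₀, hN₀⟩ := eventually_mem_Ioo_level hθ
  -- levels beyond `N₁` exit after time `t₀ - η`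
  have hlt : (((t₀ : ℝ) - η / 2).toNNReal : WithTop ℝ≥0) < lifetime U hc θ ω := by
    rw [← ht₀, WithTop.coe_lt_coe, ← NNReal.coe_lt_coe]
    rcases le_or_gt 0 ((t₀ : ℝ) - η / 2) with h | h
    · rw [Real.coe_toNNReal _ h]; linarith
    · rw [Real.toNNReal_of_nonpos h.le, NNReal.coe_zero]
      have : (0 : ℝ) ≤ t₀ := t₀.coe_nonneg
      rcases this.eq_or_lt with h0 | h0
      · exfalso
        -- `t₀ = 0` is impossible: `σₙ > 0` for large `n` and `σₙ ≤ T = t₀`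
        have hpos := truncExit_pos hc (level_pos N₀) (level_le N₀) (hN₀ N₀ le_rfl) ω
        have hle := exitLevel_le_lifetime hc N₀ θ ω
        rw [← ht₀, show t₀ = 0 from NNReal.coe_injective h0.symm] at hle
        exact not_lt.2 hle hpos
      · exact h0
  obtain ⟨N₁, hN₁⟩ := eventually_lt_exitLevel hc hlt
  set N := max (max N₀ N₁) 1 with hNdef
  have hNN₀ : N₀ ≤ N := (le_max_left _ _).trans (le_max_left _ _)
  have hNN₁ : N₁ ≤ N := (le_max_right _ _).trans (le_max_left _ _)
  have hN1 : 1 ≤ N := le_max_right _ _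
  -- the finite exit times of the levels `n ≥ N`, and their location in `(t₀ - η, t₀]`
  have hfin : ∀ n, N ≤ n → ∃ t : ℝ≥0, exitLevel U hc n θ ω = t ∧ t ≤ t₀ ∧ (t₀ : ℝ) - η < t := by
    intro n hn
    have hne : exitLevel U hc n θ ω ≠ ⊤ := ((exitLevel_lt_lifetime hc hθ hT n).trans hT).ne
    obtain ⟨t, ht⟩ := WithTop.ne_top_iff_exists.1 hne
    refine ⟨t, ht.symm, ?_, ?_⟩
    · have := exitLevel_le_lifetime hc n θ ω
      rw [← ht, ← ht₀, WithTop.coe_le_coe] at this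
      exact this
    · have := hN₁ n (hNN₁.trans hn)
      rw [← ht, WithTop.coe_lt_coe, ← NNReal.coe_lt_coe] at this
      have h2 : (t₀ : ℝ) - η / 2 ≤ ((t₀ : ℝ) - η / 2).toNNReal := Real.le_coe_toNNReal _
      linarith
  by_contra hnot
  rw [not_or] at hnot
  obtain ⟨hnt, hnb⟩ := hnot
  simp only [ExitsTop, ExitsBot, not_exists, not_forall] at hnt hnb
  obtain ⟨n, hn, hn'⟩ := hnt N
  obtain ⟨m, hm, hm'⟩ := hnb N
  have hθn := hN₀ n (hNN₀.trans hn)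
  have hθm := hN₀ m (hNN₀.trans hm)
  have hbn : BotAt U hc n θ ω := (topAt_or_botAt hc hθ hθn hT).resolve_left hn'
  have htm : TopAt U hc m θ ω := (topAt_or_botAt hc hθ hθm hT).resolve_right hm'
  obtain ⟨sn, hsn, hsnt₀, hsnη⟩ := hfin n hn
  obtain ⟨sm, hsm, hsmt₀, hsmη⟩ := hfin m hm
  obtain ⟨tn, htn, hytn⟩ := hbn
  obtain ⟨tm, htm', hytm⟩ := htm
  have e1 : tn = sn := WithTop.coe_injective (htn.symm.trans hsn)
  have e2 : tm = sm := WithTop.coe_injective (htm'.symm.trans hsm)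
  subst e1 e2
  have hlevn : level n ≤ 1 / 2 := level_le_half (hN1.trans hn)
  have hlevm : level m ≤ 1 / 2 := level_le_half (hN1.trans hm)
  have hπ := Real.pi_gt_three
  rcases lt_or_gt_of_ne (show n ≠ m from fun h ↦ by
      subst h; exact not_topAt_and_botAt hc n θ ω ⟨⟨tm, htm', hytm⟩, ⟨tn, htn, hytn⟩⟩) with hnm | hmn
  · -- `n < m`: the level-`m` flow rises from `≤ π` at `σₙ` to `2π - 2δₘ` at `σₘ`
    have hle : tn ≤ tm := by
      have hmono : exitLevel U hc n θ ω ≤ exitLevel U hc m θ ω := exitLevel_mono hc θ ω hnm.le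
      rw [htn, htm', WithTop.coe_le_coe] at hmono; exact hmono
    set y : ℝ≥0 → ℝ := fun u ↦ argLevel U hc m θ u ω with hy
    have hyc : Continuous y := continuous_argTrunc hc _ _ θ ω
    have hya : y tn ≤ Real.pi := by
      simp only [hy]
      rw [argLevel_eq_argLevel_of_le hc hnm.le hθn ω (by rw [htn]), hytn]
      linarith
    have hyb : Real.pi < y tm := by simp only [hy]; rw [hytm]; linarith
    obtain ⟨L, hL1, hL2, hyL, habove⟩ := exists_last_crossing hyc hle hya hyb
    have hrise := sub_le_driving_of_pi_le hc (level_pos m) (level_le m) θ ω hL2.le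
      (fun u hu1 hu2 ↦ by
        rcases hu1.eq_or_lt with h | h
        · rw [← h]; exact hyL.ge
        · exact (habove u h hu2).le)
    have hdU : |U ω tm - U ω L| < 1 := by
      refine hmod tm L hsmt₀ (hL2.le.trans hsmt₀) ?_
      rw [NNReal.dist_eq, abs_sub_lt_iff]
      have e1 : (L : ℝ) ≤ tm := by exact_mod_cast hL2.le
      have e2 : (tn : ℝ) ≤ L := by exact_mod_cast hL1
      have e3 : (tm : ℝ) ≤ t₀ := by exact_mod_cast hsmt₀
      constructor <;> linarith
    have h1 : y tm - y L ≤ -(U ω tm - U ω L) := hrise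
    rw [hyL] at h1
    simp only [hy] at h1
    rw [hytm] at h1
    have := neg_le_abs (U ω tm - U ω L)
    linarith
  · -- `m < n`: the level-`n` flow falls from `≥ π` at `σₘ` to `2δₙ` at `σₙ`
    have hle : tm ≤ tn := by
      have hmono : exitLevel U hc m θ ω ≤ exitLevel U hc n θ ω := exitLevel_mono hc θ ω hmn.le
      rw [htn, htm', WithTop.coe_le_coe] at hmono; exact hmono
    set y : ℝ≥0 → ℝ := fun u ↦ argLevel U hc n θ u ω with hy
    have hyc : Continuous y := continuous_argTrunc hc _ _ θ ω
    have hya : Real.pi ≤ y tm := by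
      simp only [hy]
      rw [argLevel_eq_argLevel_of_le hc hmn.le hθm ω (by rw [htm']), hytm]
      linarith
    have hyb : y tn < Real.pi := by simp only [hy]; rw [hytn]; linarith
    obtain ⟨L, hL1, hL2, hyL, hbelow⟩ := exists_last_crossing' hyc hle hya hyb
    have hfall := driving_le_sub_of_le_pi hc (level_pos n) (level_le n) θ ω hL2.le
      (fun u hu1 hu2 ↦ by
        rcases hu1.eq_or_lt with h | h
        · rw [← h]; exact hyL.le
        · exact (hbelow u h hu2).le)
    have hdU : |U ω tn - U ω L| < 1 := by
      refine hmod tn L hsnt₀ (hL2.le.trans hsnt₀) ?_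
      rw [NNReal.dist_eq, abs_sub_lt_iff]
      have e1 : (L : ℝ) ≤ tn := by exact_mod_cast hL2.le
      have e2 : (tm : ℝ) ≤ L := by exact_mod_cast hL1
      have e3 : (tn : ℝ) ≤ t₀ := by exact_mod_cast hsnt₀
      constructor <;> linarith
    have h1 : -(U ω tn - U ω L) ≤ y tn - y L := hfall
    rw [hyL] at h1
    simp only [hy] at h1
    rw [hytn] at h1
    have := le_abs_self (U ω tn - U ω L)
    linarith


/-- Finite exit data of the levels near a finite lifetime: for `t < T` there is `N` such that
every level `n ≥ N` has a finite exit time `σₙ ∈ (t, T]`, the start lies in the level-`n`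
interval, and `n ≥ 1`. [folklore] -/
theorem exists_exit_data {θ : ℝ} (hθ : θ ∈ Ioo 0 (2 * Real.pi)) {ω : Ω} {t₀ : ℝ≥0}
    (ht₀ : lifetime U hc θ ω = t₀) {t : ℝ≥0} (ht : t < t₀) :
    ∃ N : ℕ, 1 ≤ N ∧ ∀ n, N ≤ n → θ ∈ Ioo (2 * level n) (2 * Real.pi - 2 * level n) ∧
      ∃ s : ℝ≥0, exitLevel U hc n θ ω = s ∧ s ≤ t₀ ∧ t < s := by
  have hT : lifetime U hc θ ω < ⊤ := by rw [ht₀]; exact WithTop.coe_lt_top t₀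
  obtain ⟨N₀, hN₀⟩ := eventually_mem_Ioo_level hθ
  obtain ⟨N₁, hN₁⟩ := eventually_lt_exitLevel hc (t := t) (by rw [ht₀]; exact WithTop.coe_lt_coe.2 ht)
  refine ⟨max (max N₀ N₁) 1, le_max_right _ _, fun n hn ↦ ⟨hN₀ n ((le_max_left _ _).trans
    ((le_max_left _ _).trans hn)), ?_⟩⟩
  have hne : exitLevel U hc n θ ω ≠ ⊤ := ((exitLevel_lt_lifetime hc hθ hT n).trans hT).ne
  obtain ⟨s, hs⟩ := WithTop.ne_top_iff_exists.1 hne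
  refine ⟨s, hs.symm, ?_, ?_⟩
  · have := exitLevel_le_lifetime hc n θ ω
    rw [← hs, ht₀, WithTop.coe_le_coe] at this
    exact this
  · have := hN₁ n ((le_max_right _ _).trans ((le_max_left _ _).trans hn))
    rw [← hs, WithTop.coe_lt_coe] at this
    exact this

/-- **On `ExitsTop` the flow tends to `2π` as `t ↑ T`**, uniformly along the levels: for every
`ε > 0` there is `N` such that every level `n ≥ N` flow is `≥ 2π - ε` on `[σ_N, σₙ]` (LSW (2002),
p. 5: "`Yₜ → 2π` as `t ↑ T` on the event `ν = 1`"). Proof: otherwise the flow rises from `2π - ε`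
to `2π - 2δₙ ≥ 2π - ε/4` inside `[π, 2π)`, against the drift, within the modulus of continuity of
`U` for `ε/4`. [cite: LawlerSchrammWernerEJP2002, §2 p. 5] -/
theorem eventually_ge_of_exitsTop {θ : ℝ} (hθ : θ ∈ Ioo 0 (2 * Real.pi)) {ω : Ω}
    (hT : lifetime U hc θ ω < ⊤) (htop : ExitsTop U hc θ ω) {ε : ℝ} (hε : 0 < ε) :
    ∃ N : ℕ, ∀ n, N ≤ n → ∀ s : ℝ≥0, exitLevel U hc N θ ω ≤ s →
      (s : WithTop ℝ≥0) ≤ exitLevel U hc n θ ω → 2 * Real.pi - ε ≤ argLevel U hc n θ s ω := by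
  obtain ⟨t₀, ht₀⟩ := WithTop.ne_top_iff_exists.1 hT.ne
  set ε₀ := min ε Real.pi with hε₀
  have hε₀pos : 0 < ε₀ := lt_min hε Real.pi_pos
  have hε₀ε : ε₀ ≤ ε := min_le_left _ _
  have hε₀π : ε₀ ≤ Real.pi := min_le_right _ _
  obtain ⟨η, hη, hmod⟩ := exists_modulus hc ω t₀ (by positivity : 0 < ε₀ / 4)
  obtain ⟨Ntop, hNtop⟩ := htop
  -- `t₀ > 0` and the time `t₀ - η/2` (clipped at `0`) is `< t₀`
  obtain ⟨N₀, hN₀⟩ := eventually_mem_Ioo_level hθ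
  have ht₀pos : 0 < t₀ := by
    have hpos := truncExit_pos hc (level_pos N₀) (level_le N₀) (hN₀ N₀ le_rfl) ω
    have hle := exitLevel_le_lifetime hc N₀ θ ω
    rw [← ht₀] at hle
    exact WithTop.coe_pos.1 (hpos.trans_le hle)
  set t : ℝ≥0 := ((t₀ : ℝ) - η / 2).toNNReal with htdef
  have htlt : t < t₀ := by
    rw [← NNReal.coe_lt_coe]
    rcases le_or_gt 0 ((t₀ : ℝ) - η / 2) with h | h
    · rw [htdef, Real.coe_toNNReal _ h]; linarith
    · rw [htdef, Real.toNNReal_of_nonpos h.le, NNReal.coe_zero]; exact_mod_cast ht₀pos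
  have htge : (t₀ : ℝ) - η / 2 ≤ t := Real.le_coe_toNNReal _
  obtain ⟨N₁, hN₁1, hN₁⟩ := exists_exit_data hc hθ ht₀.symm htlt
  obtain ⟨N₂, hN₂⟩ := (tendsto_level.eventually (gt_mem_nhds (by positivity : 0 < ε₀ / 8))).exists_forall_of_atTop
  set N := max (max Ntop N₁) N₂ with hNdef
  have hNtop' : Ntop ≤ N := (le_max_left _ _).trans (le_max_left _ _)
  have hN₁' : N₁ ≤ N := (le_max_right _ _).trans (le_max_left _ _)
  have hN₂' : N₂ ≤ N := le_max_right _ _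
  obtain ⟨-, sN, hsN, hsNt₀, htsN⟩ := hN₁ N hN₁'
  refine ⟨N, fun n hn s hs1 hs2 ↦ ?_⟩
  obtain ⟨hθn, sn, hsn, hsnt₀, htsn⟩ := hN₁ n (hN₁'.trans hn)
  obtain ⟨tn, htn, hytn⟩ := hNtop n (hNtop'.trans hn)
  have e : tn = sn := WithTop.coe_injective (htn.symm.trans hsn)
  subst e
  suffices h : 2 * Real.pi - ε₀ ≤ argLevel U hc n θ s ω by linarith
  by_contra hlt
  rw [not_le] at hlt
  have hlev : level n < ε₀ / 8 := (hN₂ n (hN₂'.trans hn)).trans_le le_rfl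
  rw [hsN, WithTop.coe_le_coe] at hs1
  rw [hsn, WithTop.coe_le_coe] at hs2
  set y : ℝ≥0 → ℝ := fun u ↦ argLevel U hc n θ u ω with hy
  have hyc : Continuous y := continuous_argTrunc hc _ _ θ ω
  have hya : y s ≤ 2 * Real.pi - ε₀ := hlt.le
  have hyb : 2 * Real.pi - ε₀ < y tn := by simp only [hy]; rw [hytn]; linarith
  obtain ⟨L, hL1, hL2, hyL, habove⟩ := exists_last_crossing hyc hs2 hya hyb
  have hrise := sub_le_driving_of_pi_le hc (level_pos n) (level_le n) θ ω hL2.le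
    (fun u hu1 hu2 ↦ by
      rcases hu1.eq_or_lt with h | h
      · rw [← h]; change Real.pi ≤ y L; rw [hyL]; linarith
      · linarith [habove u h hu2])
  have hdU : |U ω tn - U ω L| < ε₀ / 4 := by
    refine hmod tn L hsnt₀ (hL2.le.trans hsnt₀) ?_
    rw [NNReal.dist_eq, abs_sub_lt_iff]
    have e1 : (L : ℝ) ≤ tn := by exact_mod_cast hL2.le
    have e2 : (s : ℝ) ≤ L := by exact_mod_cast hL1
    have e3 : (tn : ℝ) ≤ t₀ := by exact_mod_cast hsnt₀
    have e4 : (sN : ℝ) ≤ s := by exact_mod_cast hs1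
    have e5 : (t : ℝ) < sN := by exact_mod_cast htsN
    constructor <;> linarith
  have h1 : y tn - y L ≤ -(U ω tn - U ω L) := hrise
  rw [hyL] at h1
  simp only [hy] at h1
  rw [hytn] at h1
  have := neg_le_abs (U ω tn - U ω L)
  linarith

/-- **On `ExitsBot` the flow tends to `0` as `t ↑ T`**, uniformly along the levels: for every
`ε > 0` there is `N` such that every level `n ≥ N` flow is `≤ ε` on `[σ_N, σₙ]` (LSW (2002),
p. 5: "`Yₜ → 0` as `t ↑ T` on the event `ν = -1`"). [cite: LawlerSchrammWernerEJP2002, §2 p. 5] -/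
theorem eventually_le_of_exitsBot {θ : ℝ} (hθ : θ ∈ Ioo 0 (2 * Real.pi)) {ω : Ω}
    (hT : lifetime U hc θ ω < ⊤) (hbot : ExitsBot U hc θ ω) {ε : ℝ} (hε : 0 < ε) :
    ∃ N : ℕ, ∀ n, N ≤ n → ∀ s : ℝ≥0, exitLevel U hc N θ ω ≤ s →
      (s : WithTop ℝ≥0) ≤ exitLevel U hc n θ ω → argLevel U hc n θ s ω ≤ ε := by
  obtain ⟨t₀, ht₀⟩ := WithTop.ne_top_iff_exists.1 hT.ne
  set ε₀ := min ε Real.pi with hε₀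
  have hε₀pos : 0 < ε₀ := lt_min hε Real.pi_pos
  have hε₀ε : ε₀ ≤ ε := min_le_left _ _
  have hε₀π : ε₀ ≤ Real.pi := min_le_right _ _
  obtain ⟨η, hη, hmod⟩ := exists_modulus hc ω t₀ (by positivity : 0 < ε₀ / 4)
  obtain ⟨Nbot, hNbot⟩ := hbot
  obtain ⟨N₀, hN₀⟩ := eventually_mem_Ioo_level hθ
  have ht₀pos : 0 < t₀ := by
    have hpos := truncExit_pos hc (level_pos N₀) (level_le N₀) (hN₀ N₀ le_rfl) ω
    have hle := exitLevel_le_lifetime hc N₀ θ ω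
    rw [← ht₀] at hle
    exact WithTop.coe_pos.1 (hpos.trans_le hle)
  set t : ℝ≥0 := ((t₀ : ℝ) - η / 2).toNNReal with htdef
  have htlt : t < t₀ := by
    rw [← NNReal.coe_lt_coe]
    rcases le_or_gt 0 ((t₀ : ℝ) - η / 2) with h | h
    · rw [htdef, Real.coe_toNNReal _ h]; linarith
    · rw [htdef, Real.toNNReal_of_nonpos h.le, NNReal.coe_zero]; exact_mod_cast ht₀pos
  have htge : (t₀ : ℝ) - η / 2 ≤ t := Real.le_coe_toNNReal _
  obtain ⟨N₁, hN₁1, hN₁⟩ := exists_exit_data hc hθ ht₀.symm htlt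
  obtain ⟨N₂, hN₂⟩ := (tendsto_level.eventually (gt_mem_nhds (by positivity : 0 < ε₀ / 8))).exists_forall_of_atTop
  set N := max (max Nbot N₁) N₂ with hNdef
  have hNbot' : Nbot ≤ N := (le_max_left _ _).trans (le_max_left _ _)
  have hN₁' : N₁ ≤ N := (le_max_right _ _).trans (le_max_left _ _)
  have hN₂' : N₂ ≤ N := le_max_right _ _
  obtain ⟨-, sN, hsN, hsNt₀, htsN⟩ := hN₁ N hN₁'
  refine ⟨N, fun n hn s hs1 hs2 ↦ ?_⟩
  obtain ⟨hθn, sn, hsn, hsnt₀, htsn⟩ := hN₁ n (hN₁'.trans hn)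
  obtain ⟨tn, htn, hytn⟩ := hNbot n (hNbot'.trans hn)
  have e : tn = sn := WithTop.coe_injective (htn.symm.trans hsn)
  subst e
  suffices h : argLevel U hc n θ s ω ≤ ε₀ by linarith
  by_contra hlt
  rw [not_le] at hlt
  have hlev : level n < ε₀ / 8 := (hN₂ n (hN₂'.trans hn)).trans_le le_rfl
  rw [hsN, WithTop.coe_le_coe] at hs1
  rw [hsn, WithTop.coe_le_coe] at hs2
  set y : ℝ≥0 → ℝ := fun u ↦ argLevel U hc n θ u ω with hy
  have hyc : Continuous y := continuous_argTrunc hc _ _ θ ω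
  have hya : ε₀ ≤ y s := hlt.le
  have hyb : y tn < ε₀ := by simp only [hy]; rw [hytn]; linarith
  obtain ⟨L, hL1, hL2, hyL, hbelow⟩ := exists_last_crossing' hyc hs2 hya hyb
  have hfall := driving_le_sub_of_le_pi hc (level_pos n) (level_le n) θ ω hL2.le
    (fun u hu1 hu2 ↦ by
      rcases hu1.eq_or_lt with h | h
      · rw [← h]; change y L ≤ Real.pi; rw [hyL]; exact hε₀π
      · linarith [hbelow u h hu2])
  have hdU : |U ω tn - U ω L| < ε₀ / 4 := by
    refine hmod tn L hsnt₀ (hL2.le.trans hsnt₀) ?_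
    rw [NNReal.dist_eq, abs_sub_lt_iff]
    have e1 : (L : ℝ) ≤ tn := by exact_mod_cast hL2.le
    have e2 : (s : ℝ) ≤ L := by exact_mod_cast hL1
    have e3 : (tn : ℝ) ≤ t₀ := by exact_mod_cast hsnt₀
    have e4 : (sN : ℝ) ≤ s := by exact_mod_cast hs1
    have e5 : (t : ℝ) < sN := by exact_mod_cast htsN
    constructor <;> linarith
  have h1 : -(U ω tn - U ω L) ≤ y tn - y L := hfall
  rw [hyL] at h1
  simp only [hy] at h1
  rw [hytn] at h1
  have := le_abs_self (U ω tn - U ω L)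
  linarith

/-! ### Measurability of the exit sides -/

/-- `TopAt n` in terms of the flow stopped at `σₙ` at integer times. [folklore] -/
theorem topAt_iff_exists_nat (n : ℕ) (θ : ℝ) (ω : Ω) :
    TopAt U hc n θ ω ↔ ∃ k : ℕ, stoppedProcess (argLevel U hc n θ) (exitLevel U hc n θ) k ω =
      2 * Real.pi - 2 * level n := by
  constructor
  · rintro ⟨t, ht, hyt⟩
    obtain ⟨k, hk⟩ := exists_nat_ge t
    exact ⟨k, (Process.stoppedProcess_exitTime_eq_right_iff).2 ⟨t, hk, ht, hyt⟩⟩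
  · rintro ⟨k, hk⟩
    obtain ⟨T, -, hT, hyT⟩ := (Process.stoppedProcess_exitTime_eq_right_iff).1 hk
    exact ⟨T, hT, hyT⟩

/-- `BotAt n` in terms of the flow stopped at `σₙ` at integer times. [folklore] -/
theorem botAt_iff_exists_nat (n : ℕ) (θ : ℝ) (ω : Ω) :
    BotAt U hc n θ ω ↔ ∃ k : ℕ, stoppedProcess (argLevel U hc n θ) (exitLevel U hc n θ) k ω =
      2 * level n := by
  constructor
  · rintro ⟨t, ht, hyt⟩
    obtain ⟨k, hk⟩ := exists_nat_ge t
    exact ⟨k, (Process.stoppedProcess_exitTime_eq_left_iff).2 ⟨t, hk, ht, hyt⟩⟩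
  · rintro ⟨k, hk⟩
    obtain ⟨T, -, hT, hyT⟩ := (Process.stoppedProcess_exitTime_eq_left_iff).1 hk
    exact ⟨T, hT, hyT⟩

variable {𝓕 : Filtration ℝ≥0 mΩ}

/-- The level-`n` flow stopped at `σₙ` is measurable at each time (adapted driving path).
[folklore] -/
theorem measurable_stoppedProcess_argLevel (hU : ∀ s, Measurable[𝓕 s] fun ω ↦ U ω s) (n : ℕ)
    (θ : ℝ) (k : ℝ≥0) :
    Measurable fun ω ↦ stoppedProcess (argLevel U hc n θ) (exitLevel U hc n θ) k ω :=
  ((Process.stronglyAdapted_stoppedProcess_exitTime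
    (adapted_argTrunc hc (level_pos n) (level_le n) hU θ)
    (continuous_argTrunc hc (level_pos n) (level_le n) θ) k).measurable.mono (𝓕.le k) le_rfl)

/-- **`TopAt n` is measurable** (adapted driving path). [folklore] -/
theorem measurableSet_topAt (hU : ∀ s, Measurable[𝓕 s] fun ω ↦ U ω s) (n : ℕ) (θ : ℝ) :
    MeasurableSet {ω | TopAt U hc n θ ω} := by
  have : {ω | TopAt U hc n θ ω} = ⋃ k : ℕ, {ω | stoppedProcess (argLevel U hc n θ)
      (exitLevel U hc n θ) k ω = 2 * Real.pi - 2 * level n} := by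
    ext ω; simp only [mem_setOf_eq, topAt_iff_exists_nat, mem_iUnion]
  rw [this]
  exact MeasurableSet.iUnion fun k ↦
    (measurable_stoppedProcess_argLevel hc hU n θ k) (measurableSet_singleton _)

/-- **`BotAt n` is measurable** (adapted driving path). [folklore] -/
theorem measurableSet_botAt (hU : ∀ s, Measurable[𝓕 s] fun ω ↦ U ω s) (n : ℕ) (θ : ℝ) :
    MeasurableSet {ω | BotAt U hc n θ ω} := by
  have : {ω | BotAt U hc n θ ω} = ⋃ k : ℕ, {ω | stoppedProcess (argLevel U hc n θ)
      (exitLevel U hc n θ) k ω = 2 * level n} := by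
    ext ω; simp only [mem_setOf_eq, botAt_iff_exists_nat, mem_iUnion]
  rw [this]
  exact MeasurableSet.iUnion fun k ↦
    (measurable_stoppedProcess_argLevel hc hU n θ k) (measurableSet_singleton _)

/-- **`ExitsTop` is measurable** (adapted driving path). [folklore] -/
theorem measurableSet_exitsTop (hU : ∀ s, Measurable[𝓕 s] fun ω ↦ U ω s) (θ : ℝ) :
    MeasurableSet {ω | ExitsTop U hc θ ω} := by
  have : {ω | ExitsTop U hc θ ω} = ⋃ N : ℕ, ⋂ n : ℕ, {ω | N ≤ n → TopAt U hc n θ ω} := by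
    ext ω; simp only [ExitsTop, mem_setOf_eq, mem_iUnion, mem_iInter]
  rw [this]
  refine MeasurableSet.iUnion fun N ↦ MeasurableSet.iInter fun n ↦ ?_
  by_cases h : N ≤ n
  · simp only [h, forall_const]; exact measurableSet_topAt hc hU n θ
  · simp only [h, IsEmpty.forall_iff, setOf_true]; exact MeasurableSet.univ

/-- **`ExitsBot` is measurable** (adapted driving path). [folklore] -/
theorem measurableSet_exitsBot (hU : ∀ s, Measurable[𝓕 s] fun ω ↦ U ω s) (θ : ℝ) :
    MeasurableSet {ω | ExitsBot U hc θ ω} := by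
  have : {ω | ExitsBot U hc θ ω} = ⋃ N : ℕ, ⋂ n : ℕ, {ω | N ≤ n → BotAt U hc n θ ω} := by
    ext ω; simp only [ExitsBot, mem_setOf_eq, mem_iUnion, mem_iInter]
  rw [this]
  refine MeasurableSet.iUnion fun N ↦ MeasurableSet.iInter fun n ↦ ?_
  by_cases h : N ≤ n
  · simp only [h, forall_const]; exact measurableSet_botAt hc hU n θ
  · simp only [h, IsEmpty.forall_iff, setOf_true]; exact MeasurableSet.univ


/-! ### The radial Bessel flow up to its lifetime -/

open scoped Classical in
variable (U) in
/-- **The radial Bessel flow** `Y = arg U hc θ : ℝ≥0 → Ω → ℝ` started at `θ`: LSW's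
`Yₜ^θ = -i log gₜ(e^{iθ}) - √κ Bₜ` ((2.9); `dYₜ = cot(Yₜ/2) dt - √κ dBₜ`, (2.11)) / Lawler's
`Yₜ = hₜ(x) - √κ Bₜ` ((6.12)), for a general continuous driving path `U ω` in place of `√κ B`:
the solution of `Yₜ = θ + ∫₀ᵗ cot(Y_s/2) ds - (Uₜ - U₀)` on `[0, T)` (`arg_eq_integral`), valued
in `(0, 2π)` there (`arg_mem_Ioo`). It is assembled from the truncated flows: at a time
`t ≤ σₙ` it is the level-`n` flow (`arg_eq_argLevel`; the levels are consistent). **Junk value**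
`0` from the lifetime `T` on. [cite: LawlerSchrammWernerEJP2002, §2 (2.9)–(2.11)] -/
def arg (hc : ∀ ω, Continuous (U ω)) (θ : ℝ) : ℝ≥0 → Ω → ℝ := fun t ω ↦
  if h : ∃ n : ℕ, (t : WithTop ℝ≥0) ≤ exitLevel U hc n θ ω then argLevel U hc (Nat.find h) θ t ω
  else 0

/-- **The flow is the level-`n` flow up to `σₙ`** (any level `n`; the levels are consistent, and
a level whose interval does not contain the start has `σₙ = 0`). [folklore] -/
theorem arg_eq_argLevel {n : ℕ} {θ : ℝ} {ω : Ω} {t : ℝ≥0}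
    (ht : (t : WithTop ℝ≥0) ≤ exitLevel U hc n θ ω) :
    arg U hc θ t ω = argLevel U hc n θ t ω := by
  classical
  have h : ∃ n : ℕ, (t : WithTop ℝ≥0) ≤ exitLevel U hc n θ ω := ⟨n, ht⟩
  rw [arg, dif_pos h]
  set m := Nat.find h with hm
  have hmt : (t : WithTop ℝ≥0) ≤ exitLevel U hc m θ ω := Nat.find_spec h
  have hmn : m ≤ n := Nat.find_min' h ht
  by_cases hθm : θ ∈ Ioo (2 * level m) (2 * Real.pi - 2 * level m)
  · exact (argLevel_eq_argLevel_of_le hc hmn hθm ω hmt).symm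
  · have h0 := exitLevel_eq_zero_of_not_mem hc hθm ω
    rw [h0, nonpos_iff_eq_zero, WithTop.coe_eq_zero] at hmt
    rw [hmt]
    change argTrunc U (level m) hc _ _ θ 0 ω = argTrunc U (level n) hc _ _ θ 0 ω
    rw [argTrunc_zero, argTrunc_zero]

/-- The flow starts at `θ`. [folklore] -/
@[simp] theorem arg_zero (θ : ℝ) (ω : Ω) : arg U hc θ 0 ω = θ := by
  classical
  have h : ∃ n : ℕ, ((0 : ℝ≥0) : WithTop ℝ≥0) ≤ exitLevel U hc n θ ω := ⟨0, bot_le⟩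
  rw [arg, dif_pos h]
  exact argTrunc_zero hc _ _ θ ω

/-- **Before its lifetime the flow is in `(0, 2π)`** (start in `(0, 2π)`). [folklore] -/
theorem arg_mem_Ioo {θ : ℝ} (hθ : θ ∈ Ioo 0 (2 * Real.pi)) {ω : Ω} {t : ℝ≥0}
    (ht : (t : WithTop ℝ≥0) < lifetime U hc θ ω) : arg U hc θ t ω ∈ Ioo 0 (2 * Real.pi) := by
  obtain ⟨N₀, hN₀⟩ := eventually_mem_Ioo_level hθ
  obtain ⟨N₁, hN₁⟩ := eventually_lt_exitLevel hc ht
  have hθn := hN₀ (max N₀ N₁) (le_max_left _ _)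
  have htn := hN₁ (max N₀ N₁) (le_max_right _ _)
  rw [arg_eq_argLevel hc htn.le]
  have hmem := argTrunc_mem_Ioo_of_lt_truncExit hc (level_pos _) (level_le _) θ ω htn
  have hl := level_pos (max N₀ N₁)
  exact ⟨by linarith [hmem.1], by linarith [hmem.2]⟩

/-- The flow is continuous on `[0, t]` for every `t ≤ σₙ` (there it is the continuous level-`n`
flow). [folklore] -/
theorem continuousOn_arg {n : ℕ} {θ : ℝ} {ω : Ω} {t : ℝ≥0}
    (ht : (t : WithTop ℝ≥0) ≤ exitLevel U hc n θ ω) :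
    ContinuousOn (fun s ↦ arg U hc θ s ω) (Iic t) :=
  ((continuous_argTrunc hc (level_pos n) (level_le n) θ ω).continuousOn).congr
    fun _ hs ↦ arg_eq_argLevel hc ((WithTop.coe_le_coe.2 hs).trans ht)

/-- **The radial Bessel equation, integrated**: for `t ≤ σₙ` (start inside the level-`n`
interval, in particular for every `t < T`),
`Yₜ = θ + ∫₀ᵗ cot(Y_s/2) ds - (Uₜ - U₀)` — Lawler (2005), (6.12)–(6.13); LSW (2002), (2.11)
(`dYₜ = cot(Yₜ/2) dt - √κ dBₜ`, with `U = √κ B`). [cite: Lawler2005, §6.4 eq. (6.12)] -/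
theorem arg_eq_integral {n : ℕ} {θ : ℝ} (hθn : θ ∈ Ioo (2 * level n) (2 * Real.pi - 2 * level n))
    {ω : Ω} {t : ℝ≥0} (ht : (t : WithTop ℝ≥0) ≤ exitLevel U hc n θ ω) :
    arg U hc θ t ω = θ + (∫ s in (0 : ℝ)..t, Real.cot (arg U hc θ s.toNNReal ω / 2)) -
      (U ω t - U ω 0) := by
  rw [arg_eq_argLevel hc ht, argLevel, argTrunc_eq_integral hc (level_pos n) (level_le n) θ ω]
  congr 2
  refine intervalIntegral.integral_congr fun s hs ↦ ?_
  rw [uIcc_of_le t.coe_nonneg] at hs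
  have hst : ((s.toNNReal : ℝ≥0) : WithTop ℝ≥0) ≤ exitLevel U hc n θ ω :=
    (WithTop.coe_le_coe.2 ((Real.toNNReal_le_iff_le_coe).2 hs.2)).trans ht
  have hmem := argTrunc_mem_Icc_of_le_truncExit hc (level_pos n) (level_le n) hθn ω hst
  rw [arg_eq_argLevel hc hst, cotTrunc_eq_cot]
  constructor <;> linarith [hmem.1, hmem.2]

end Lifetime

end RadialLoewner

end Literature.Probability.RandomPlanarGeometry
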